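import Summits.NavierStokesRegularity.NavierStokesRegularity.Theorems.SwirlGaugedTower
import Summits.NavierStokesRegularity.NavierStokesRegularity.Theorems.SwirlHolderTowerFunnel
import HarnessLib

/-!
# SwirlGaugedTower, part 2 — the gauged global statements, the rate dictionary and the linear vacuity
# of swirl gauging (ROUND-16 §§4–6, seat nsreg-p2)

Second half of planner nsreg-p2's `R16-SwirlGaugedTower.lean` (split for the 400-line rule; see the
module docstring of `…Theorems.SwirlGaugedTower` for the mechanism and the sources): §4 the gauged
global statements `GaugedWeakL3Regularity`, `@[conjecture] OzanskiPalasekPolynomial`,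
`OzanskiPalasekDoubleExpGauged` (+ `printed_toGaugedDoubleExp`, `.toGaugedDoubleExp`), the rate
classes `GaugedWeakL3Rate`, `@[conjecture] WeakL3PowerRate`, `WeakL3LogRateGauged`,
`WeakL3LogLogRateGauged` and their ordering; §5 the rate dictionary (`rate_of_poly`) and the exclusion
of polylog scenarios (`polylog_scenario_excluded`); §6 the linear vacuity of swirl gauging
(`gaugedExponent_le_of_cone`, `gaugedExponent_nonpos_of_funnels`).
WHAT THIS IS NOT: not NS regularity — typed quantitative shadows inside the settled axisymmetric
regime; hard cores untouched.
-/

namespace Summit.NavierStokesRegularity.NavierStokesRegularity.Theorems.SwirlGaugedTower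

open MeasureTheory Set Filter Topology Metric WithLp
open scoped ENNReal NNReal Laplacian
open Literature.Analysis Literature.Analysis.FluidPDE Literature.Analysis.FluidPDE.ChenTsaiZhang2022
open Summit.NavierStokesRegularity.NavierStokesRegularity.Theorems.SwirlHolderTower (smallnessRadius towerBound
  exponent_le_of_rpow_le)


noncomputable section

/-! ## 4. The gauged global statements and their place above print -/

/-- **GAUGED QUANTITATIVE REGULARITY with bound shape `Φ C D A`**: Ożański–Palasek Thm 1.1
verbatim (tree rendering `ozanskiPalasek2022_axisym_weakL3_quantitative`) with ONE extra
hypothesis — the swirl datum bound `|r u^θ(0)| ≤ Γ₀` — and constants allowed to depend on `Γ₀`.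
Two independent parameters: slaving `Γ₀ ≤ C·A` (always true after their normalisation? no: `Γ₀`
is NOT bounded by `A`) would give back nothing new; the content is the dependence on `A` at FIXED
`Γ₀`. -/
def GaugedWeakL3Regularity (Φ : ℝ → ℝ → ℝ → ℝ) : Prop :=
  ∀ Γ₀ : ℝ, 0 ≤ Γ₀ → ∃ C D A₀ : ℝ, 0 < C ∧ 0 < D ∧
    ∀ (T A : ℝ) (u : ℝ → (EuclideanSpace ℝ (Fin 3)) → (EuclideanSpace ℝ (Fin 3))) (p : ℝ → (EuclideanSpace ℝ (Fin 3)) → ℝ),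
      IsHkClassicalSolutionOn (Icc 0 T) u p →
      (∀ t ∈ Icc 0 T, IsAxisymmetric (u t)) →
      (∀ t ∈ Icc 0 T, FunctionSpaces.eWeakLpPow (u t) 3 volume ≤ ENNReal.ofReal A ^ (3 : ℝ)) →
      A₀ ≤ A →
      (∀ x : (EuclideanSpace ℝ (Fin 3)), |swirl (u 0) x| ≤ Γ₀) →
      ∀ t ∈ Ioc 0 T, ∀ x : (EuclideanSpace ℝ (Fin 3)),
        ‖u t x‖ ≤ Φ C D A * t ^ (-(1 / 2 : ℝ)) ∧
        ‖fderiv ℝ (u t) x‖ ≤ Φ C D A * t ^ (-(1 : ℝ))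

/-- **POLYNOMIAL OŻAŃSKI–PALASEK at fixed swirl Reynolds number** (typed target, OPEN; the global
shadow of `SwirlGaugedLaw` by Ożański–Palasek §7 + `towerBound_of_constExponent`):
`‖u(t)‖_∞ ≤ C(Γ₀) A^{D(Γ₀)} t^{-1/2}`, `‖∇u(t)‖_∞ ≤ C(Γ₀) A^{D(Γ₀)} t^{-1}`. -/
@[conjecture] def OzanskiPalasekPolynomial : Prop :=
  GaugedWeakL3Regularity (fun C D A => C * A ^ D)

/-- Print's double-exponential shape, gauged (a CONSEQUENCE of the printed theorem:
`printed_toGaugedDoubleExp`). -/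
def OzanskiPalasekDoubleExpGauged : Prop :=
  GaugedWeakL3Regularity (fun C _ A => palasekDoubleExp C A)

/-- The printed theorem implies its gauged form (drop the swirl hypothesis). -/
theorem printed_toGaugedDoubleExp (h : ozanskiPalasek2022_axisym_weakL3_quantitative) :
    OzanskiPalasekDoubleExpGauged := by
  obtain ⟨C, A₀, hC, h⟩ := h
  intro Γ₀ _
  exact ⟨C, 1, A₀, hC, one_pos, fun T A u p hu hax h3 hA _ t ht x => h T A u p hu hax h3 hA t ht x⟩

/-- Elementary growth: `C A^D ≤ exp exp A` once `A ≥ max(1, C, 2D+2)`. -/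
theorem poly_le_expExp {C D A : ℝ} (hD : 0 < D) (h1 : 1 ≤ A) (hCA : C ≤ A)
    (hDA : 2 * D + 2 ≤ A) : C * A ^ D ≤ Real.exp (Real.exp A) := by
  have hA0 : 0 < A := by linarith
  -- `A^D = exp(D log A) ≤ exp(D A)` and `C ≤ exp C`-free: `C A^D ≤ exp(C + D A)`
  have hlogA : Real.log A ≤ A := (Real.log_le_sub_one_of_pos hA0).trans (by linarith)
  have hAD : A ^ D = Real.exp (D * Real.log A) := by
    rw [Real.rpow_def_of_pos hA0, mul_comm]
  have hpow : A ^ D ≤ Real.exp (D * A) := by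
    rw [hAD]; exact Real.exp_le_exp.mpr (mul_le_mul_of_nonneg_left hlogA hD.le)
  have hCexp : C ≤ Real.exp C := (Real.add_one_le_exp C).trans' (by linarith) |>.trans' le_rfl
  have hstep : C * A ^ D ≤ Real.exp (C + D * A) := by
    rw [Real.exp_add]
    have := mul_le_mul hCexp hpow (Real.rpow_nonneg hA0.le D) (Real.exp_pos C).le
    exact this
  -- `C + D A ≤ A²/2 ≤ exp A`
  have hquad : C + D * A ≤ Real.exp A := by
    have hq := Real.quadratic_le_exp_of_nonneg hA0.le
    nlinarith
  exact hstep.trans (Real.exp_le_exp.mpr hquad)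

/-- **POLYNOMIAL ⇒ (gauged) DOUBLE EXPONENTIAL**: the polynomial statement sits above print's shape
in the tower order (with `C' = 1`: `C A^D ≤ exp exp A = palasekDoubleExp 1 A` for large `A`). -/
theorem OzanskiPalasekPolynomial.toGaugedDoubleExp (h : OzanskiPalasekPolynomial) :
    OzanskiPalasekDoubleExpGauged := by
  intro Γ₀ hΓ₀
  obtain ⟨C, D, A₀, hC, hD, h⟩ := h Γ₀ hΓ₀
  refine ⟨1, 1, max A₀ (max 1 (max C (2 * D + 2))), one_pos, one_pos, ?_⟩
  intro T A u p hu hax h3 hA hΓ t ht x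
  have hA₀ : A₀ ≤ A := le_trans (le_max_left _ _) hA
  have h1 : 1 ≤ A := le_trans (le_trans (le_max_left _ _) (le_max_right _ _)) hA
  have hCA : C ≤ A :=
    le_trans (le_trans (le_trans (le_max_left _ _) (le_max_right _ _)) (le_max_right _ _)) hA
  have hDA : 2 * D + 2 ≤ A :=
    le_trans (le_trans (le_trans (le_max_right _ _) (le_max_right _ _)) (le_max_right _ _)) hA
  obtain ⟨h0, h1'⟩ := h T A u p hu hax h3 hA₀ hΓ t ht x
  have hle : C * A ^ D ≤ palasekDoubleExp 1 A := by
    unfold palasekDoubleExp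
    rw [Real.rpow_one]
    exact poly_le_expExp hD h1 hCA hDA
  have ht0 : 0 < t := ht.1
  exact ⟨h0.trans (mul_le_mul_of_nonneg_right hle (Real.rpow_nonneg ht0.le _)),
    h1'.trans (mul_le_mul_of_nonneg_right hle (Real.rpow_nonneg ht0.le _))⟩

/-- **GAUGED BLOW-UP RATE with rate shape `F c y`** (`y = (T₀ - t)⁻¹`): Ożański–Palasek Cor. 1.2
verbatim (tree rendering `ozanskiPalasek2022_axisym_weakL3_blowup_rate`) with the swirl datum
hypothesis and `c = c(Γ₀)`: `limsup_{t ↑ T₀} ‖u(t)‖_{L^{3,∞}} / F(c, (T₀-t)⁻¹) = ∞`. -/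
def GaugedWeakL3Rate (F : ℝ → ℝ → ℝ) : Prop :=
  ∀ Γ₀ : ℝ, 0 ≤ Γ₀ → ∃ c : ℝ, 0 < c ∧ ∀ (T₀ : ℝ), 0 < T₀ →
    ∀ (u : ℝ → (EuclideanSpace ℝ (Fin 3)) → (EuclideanSpace ℝ (Fin 3))) (p : ℝ → (EuclideanSpace ℝ (Fin 3)) → ℝ),
      (∀ T' ∈ Ioo 0 T₀, IsHkClassicalSolutionOn (Icc 0 T') u p) →
      (∀ t ∈ Ico 0 T₀, IsAxisymmetric (u t)) →
      (∀ B : ℝ, ∃ t ∈ Ico 0 T₀, ∃ x : (EuclideanSpace ℝ (Fin 3)), B < ‖u t x‖) →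
      (∀ x : (EuclideanSpace ℝ (Fin 3)), |swirl (u 0) x| ≤ Γ₀) →
      ∀ K : ℝ, ∃ᶠ t in 𝓝[<] T₀,
        ENNReal.ofReal (K * F c (T₀ - t)⁻¹) ^ (3 : ℝ) < FunctionSpaces.eWeakLpPow (u t) 3 volume

/-- power shape `y^c` — ROUND-16's target class. -/
def powerShape (c y : ℝ) : ℝ := y ^ c
/-- logarithmic shape `(log y)^c` — ROUND-15's target class. -/
def logShape (c y : ℝ) : ℝ := Real.log y ^ c
/-- double-logarithmic shape `(log log y)^c` — print (Ożański–Palasek Cor. 1.2). -/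
def loglogShape (c y : ℝ) : ℝ := Real.log (Real.log y) ^ c

/-- **POWER-TYPE weak-`L³` BLOW-UP RATE at fixed swirl Reynolds number** (typed target, OPEN):
`∀ Γ₀ ∃ δ(Γ₀) > 0`, `limsup_{t ↑ T₀} (T₀-t)^δ ‖u(t)‖_{L^{3,∞}} = ∞` for every axisymmetric
classical solution blowing up at `T₀` with `|r u^θ(0)| ≤ Γ₀`.  The class in which NO
polylog-corrected Type-I scenario survives (`polylog_scenario_excluded`). -/
@[conjecture] def WeakL3PowerRate : Prop := GaugedWeakL3Rate powerShape

/-- ROUND-15's logarithmic class, gauged. -/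
def WeakL3LogRateGauged : Prop := GaugedWeakL3Rate logShape

/-- Print's double-logarithmic class, gauged (a consequence of the printed Cor. 1.2). -/
def WeakL3LogLogRateGauged : Prop := GaugedWeakL3Rate loglogShape

/-- The printed corollary implies its gauged form. -/
theorem printed_toGaugedLogLog (h : ozanskiPalasek2022_axisym_weakL3_blowup_rate) :
    WeakL3LogLogRateGauged := by
  obtain ⟨c, hc, h⟩ := h
  intro Γ₀ _
  exact ⟨c, hc, fun T₀ hT₀ u p hu hax hblow _ K => h T₀ hT₀ u p hu hax hblow K⟩

/-- `(T₀ - t)⁻¹ → +∞` as `t ↑ T₀`. -/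
theorem tendsto_inv_sub_atTop (T₀ : ℝ) :
    Tendsto (fun t : ℝ => (T₀ - t)⁻¹) (𝓝[<] T₀) atTop := by
  have h1 : Tendsto (fun t : ℝ => T₀ - t) (𝓝[<] T₀) (𝓝[>] 0) := by
    apply tendsto_nhdsWithin_of_tendsto_nhds_of_eventually_within
    · have : Tendsto (fun t : ℝ => T₀ - t) (𝓝 T₀) (𝓝 (T₀ - T₀)) :=
        (continuous_sub_left T₀).tendsto T₀
      rw [sub_self] at this
      exact this.mono_left nhdsWithin_le_nhds
    · filter_upwards [self_mem_nhdsWithin] with t ht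
      exact mem_Ioi.mpr (sub_pos.mpr (mem_Iio.mp ht))
  exact tendsto_inv_nhdsGT_zero.comp h1

/-- **SHAPE MONOTONICITY of gauged rates**: if for every exponent `c > 0` some `F₁(c', ·) ≥ 0` is
eventually dominated by `F₂(c, ·)`, then a rate of shape `F₂` implies one of shape `F₁`. -/
theorem GaugedWeakL3Rate.of_eventually_le {F₁ F₂ : ℝ → ℝ → ℝ}
    (hdom : ∀ c : ℝ, 0 < c → ∃ c' : ℝ, 0 < c' ∧ ∀ᶠ y in atTop, 0 ≤ F₁ c' y ∧ F₁ c' y ≤ F₂ c y)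
    (h : GaugedWeakL3Rate F₂) : GaugedWeakL3Rate F₁ := by
  intro Γ₀ hΓ₀
  obtain ⟨c, hc, h⟩ := h Γ₀ hΓ₀
  obtain ⟨c', hc', hev⟩ := hdom c hc
  refine ⟨c', hc', fun T₀ hT₀ u p hu hax hblow hΓ K => ?_⟩
  have hfreq := h T₀ hT₀ u p hu hax hblow hΓ K
  have hev' : ∀ᶠ t in 𝓝[<] T₀,
      0 ≤ F₁ c' (T₀ - t)⁻¹ ∧ F₁ c' (T₀ - t)⁻¹ ≤ F₂ c (T₀ - t)⁻¹ :=
    (tendsto_inv_sub_atTop T₀).eventually hev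
  refine (hfreq.and_eventually hev').mono ?_
  rintro t ⟨hlt, h0, hle⟩
  have hmono : ENNReal.ofReal (K * F₁ c' (T₀ - t)⁻¹) ≤ ENNReal.ofReal (K * F₂ c (T₀ - t)⁻¹) := by
    by_cases hK : 0 ≤ K
    · exact ENNReal.ofReal_le_ofReal (mul_le_mul_of_nonneg_left hle hK)
    · push Not at hK
      rw [ENNReal.ofReal_of_nonpos (mul_nonpos_of_nonpos_of_nonneg hK.le h0)]
      exact bot_le
  exact lt_of_le_of_lt (ENNReal.rpow_le_rpow hmono (by norm_num)) hlt

/-- `(log y)^c ≤ y^c` for `y ≥ 1`. -/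
theorem logShape_le_powerShape {c y : ℝ} (hc : 0 ≤ c) (hy : 1 ≤ y) :
    0 ≤ logShape c y ∧ logShape c y ≤ powerShape c y := by
  have hlog0 : 0 ≤ Real.log y := Real.log_nonneg hy
  have hlogle : Real.log y ≤ y := (Real.log_le_sub_one_of_pos (by linarith)).trans (by linarith)
  exact ⟨Real.rpow_nonneg hlog0 c, Real.rpow_le_rpow hlog0 hlogle hc⟩

/-- `(log log y)^c ≤ (log y)^c` for `y ≥ e`. -/
theorem loglogShape_le_logShape {c y : ℝ} (hc : 0 ≤ c) (hy : Real.exp 1 ≤ y) :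
    0 ≤ loglogShape c y ∧ loglogShape c y ≤ logShape c y := by
  have hy0 : 0 < y := lt_of_lt_of_le (Real.exp_pos 1) hy
  have hlog1 : 1 ≤ Real.log y := by
    have := Real.log_le_log (Real.exp_pos 1) hy
    rwa [Real.log_exp] at this
  have hll0 : 0 ≤ Real.log (Real.log y) := Real.log_nonneg hlog1
  have hllle : Real.log (Real.log y) ≤ Real.log y :=
    (Real.log_le_sub_one_of_pos (by linarith)).trans (by linarith)
  exact ⟨Real.rpow_nonneg hll0 c, Real.rpow_le_rpow hll0 hllle hc⟩

/-- **POWER ⇒ LOG** (ROUND-16's class contains ROUND-15's). -/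
theorem WeakL3PowerRate.toLogRate (h : WeakL3PowerRate) : WeakL3LogRateGauged := by
  refine GaugedWeakL3Rate.of_eventually_le (fun c hc => ⟨c, hc, ?_⟩) h
  filter_upwards [eventually_ge_atTop (1 : ℝ)] with y hy
  exact logShape_le_powerShape hc.le hy

/-- **LOG ⇒ LOG LOG** (ROUND-15's class contains print's shape). -/
theorem WeakL3LogRateGauged.toLogLogRate (h : WeakL3LogRateGauged) : WeakL3LogLogRateGauged := by
  refine GaugedWeakL3Rate.of_eventually_le (fun c hc => ⟨c, hc, ?_⟩) h
  filter_upwards [eventually_ge_atTop (Real.exp 1)] with y hy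
  exact loglogShape_le_logShape hc.le hy

/-- The tower order of the three rate classes: power ⇒ log ⇒ log log (⇐ print). -/
theorem WeakL3PowerRate.toLogLogRate (h : WeakL3PowerRate) : WeakL3LogLogRateGauged :=
  h.toLogRate.toLogLogRate

/-! ## 5. Rate dictionary (power law) and the exclusion of polylog scenarios -/

/-- **RATE DICTIONARY, polynomial**: a bound `K a^D ≥ M ≥ 0` forces `a ≥ (M/K)^{1/D}`.  With
`M = ‖u(t)‖_∞ √t ≥ c_L √t (T₀-t)^{-1/2}` (Leray's lower bound, as used in Ożański–Palasek §1.3)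
this turns `OzanskiPalasekPolynomial` into the power rate `A(t) ≳ (T₀-t)^{-1/(2D)}` for the
`L^∞_t L^{3,∞}_x([0,t])` norm — `WeakL3PowerRate` with `δ = 1/(2D(Γ₀))`. -/
theorem rate_of_poly {K a M D : ℝ} (hK : 0 < K) (hD : 0 < D) (ha : 0 ≤ a) (hM : 0 ≤ M)
    (h : M ≤ K * a ^ D) : (M / K) ^ (1 / D) ≤ a := by
  have h1 : M / K ≤ a ^ D := by rw [div_le_iff₀ hK]; linarith
  have h2 : (M / K) ^ (1 / D) ≤ (a ^ D) ^ (1 / D) :=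
    Real.rpow_le_rpow (div_nonneg hM hK.le) h1 (by positivity)
  rwa [← Real.rpow_mul ha, mul_one_div_cancel hD.ne', Real.rpow_one] at h2

/-- `(log y)^q ≤ (q/δ)^q · y^δ` for `y ≥ 1`, `q, δ > 0` (from `log y ≤ y^ε/ε` with `ε = δ/q`). -/
theorem log_rpow_le_mul_rpow {q δ y : ℝ} (hq : 0 < q) (hδ : 0 < δ) (hy : 1 ≤ y) :
    Real.log y ^ q ≤ (q / δ) ^ q * y ^ δ := by
  have hy0 : 0 ≤ y := by linarith
  have hε : 0 < δ / q := div_pos hδ hq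
  have hlog0 : 0 ≤ Real.log y := Real.log_nonneg hy
  have h1 : Real.log y ≤ y ^ (δ / q) / (δ / q) := Real.log_le_rpow_div hy0 hε
  have h2 : y ^ (δ / q) / (δ / q) = (q / δ) * y ^ (δ / q) := by
    field_simp
  rw [h2] at h1
  have h3 : Real.log y ^ q ≤ ((q / δ) * y ^ (δ / q)) ^ q := Real.rpow_le_rpow hlog0 h1 hq.le
  have h4 : ((q / δ) * y ^ (δ / q)) ^ q = (q / δ) ^ q * y ^ δ := by
    rw [Real.mul_rpow (div_nonneg hq.le hδ.le) (Real.rpow_nonneg hy0 _), ← Real.rpow_mul hy0,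
      div_mul_cancel₀ δ hq.ne']
  rwa [h4] at h3

/-- **POLYLOG SCENARIOS ARE EXCLUDED BY A POWER RATE.**  If along a solution a (critical) quantity
`𝒜(t)` grows at most poly-logarithmically, `𝒜(t) ≤ K₁ (log (T₀-t)⁻¹)^q` near `T₀` — as in every
log-corrected Type-I axisymmetric scenario, e.g. the fitted scaling of Hou 2022 §3.4
(`‖u‖_∞ ∼ (T-t)^{-1/2}`, `Z(t) ∼ (T-t)^{1/2}`, `‖ω‖_∞ ∼ |log(T-t)|/(T-t)`) — then `𝒜` does NOT
have a power-type rate: `¬ ∀ K, ∃ᶠ t → T₀⁻, K ((T₀-t)⁻¹)^δ < 𝒜(t)`.  So `WeakL3PowerRate` at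
`Γ₀ = R_Γ(Hou) ≈ 1.3·10⁴` and a blow-up with Hou's fitted rates cannot both hold. -/
theorem polylog_scenario_excluded {𝒜 : ℝ → ℝ} {T₀ q δ K₁ : ℝ} (hq : 0 < q) (hδ : 0 < δ)
    (hK₁ : 0 < K₁) (hpolylog : ∀ᶠ t in 𝓝[<] T₀, 𝒜 t ≤ K₁ * Real.log (T₀ - t)⁻¹ ^ q) :
    ¬ ∀ K : ℝ, ∃ᶠ t in 𝓝[<] T₀, K * ((T₀ - t)⁻¹) ^ δ < 𝒜 t := by
  intro hpower
  set K : ℝ := K₁ * (q / δ) ^ q with hK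
  have hev1 : ∀ᶠ t in 𝓝[<] T₀, (1 : ℝ) ≤ (T₀ - t)⁻¹ :=
    (tendsto_inv_sub_atTop T₀).eventually (eventually_ge_atTop 1)
  have hfalse : ∃ᶠ t in 𝓝[<] T₀, False := by
    refine ((hpower K).and_eventually (hpolylog.and hev1)).mono ?_
    rintro t ⟨hlt, hle, h1⟩
    have hdom : K₁ * Real.log (T₀ - t)⁻¹ ^ q ≤ K * ((T₀ - t)⁻¹) ^ δ := by
      rw [hK, mul_assoc]
      exact mul_le_mul_of_nonneg_left (log_rpow_le_mul_rpow hq hδ h1) hK₁.le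
    linarith
  exact hfalse.exists.elim fun _ h => h

/-! ## 6. Linear vacuity of swirl gauging (the rung is Navier–Stokes-essential) -/

-- `exponent_le_of_rpow_le`: the tree's `…Theorems.SwirlHolderTower` (ROUND-15 §3), reused.

/-- **A SWIRL-GAUGED LAW ON A CONE IS A CONSTANT-EXPONENT LAW.**  Abstract form of the linear
vacuity: `osc r` is the oscillation on `B̄_r` of ONE member `Θ` of a class closed under
`Θ ↦ λΘ` (`λ > 0`) — the steady passive swirls of ROUND-15 (`IsSteadyPassiveSwirl N b ·` is a
linear condition in `Θ`) — with `osc 1 = S₀ > 0` and saturating an exponent `g`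
(`m r^g ≤ osc r`; the funnel's separable solution `|x|^{γ(N)} G(x₃/|x|)` does, with
`g = γ(N)`, ROUND-15 `separableSwirl_bounds`).  If a swirl-gauged law holds on the cone
(`λ·osc r ≤ K r^{γ₁(λ S₀)} · λS₀` for every `λ > 0`), then `γ₁ ≤ g` EVERYWHERE on `(0, ∞)`:
gauging by the swirl size buys nothing in a linear class. -/
theorem gaugedExponent_le_of_cone {osc : ℝ → ℝ} {S₀ m g K : ℝ} {γ₁ : ℝ → ℝ} (hS₀ : 0 < S₀)
    (hm : 0 < m) (hK : 0 < K)
    (hlow : ∀ r : ℝ, 0 < r → r ≤ 1 → m * r ^ g ≤ osc r)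
    (hlaw : ∀ l : ℝ, 0 < l → ∀ r : ℝ, 0 < r → r ≤ 1 →
      l * osc r ≤ K * r ^ (γ₁ (l * S₀)) * (l * S₀)) :
    ∀ s : ℝ, 0 < s → γ₁ s ≤ g := by
  intro s hs
  set l : ℝ := s / S₀ with hl
  have hlpos : 0 < l := div_pos hs hS₀
  have hlS : l * S₀ = s := by rw [hl]; field_simp
  apply exponent_le_of_rpow_le (K' := K * S₀ / m) (by positivity)
  intro r hr hr1
  have h1 := hlaw l hlpos r hr hr1
  rw [hlS] at h1
  have h2 := hlow r hr hr1
  -- `l m r^g ≤ l osc r ≤ K r^{γ₁ s} s = l (K r^{γ₁ s} S₀)`; cancel `l > 0`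
  have h3 : l * (m * r ^ g) ≤ K * r ^ (γ₁ s) * s :=
    (mul_le_mul_of_nonneg_left h2 hlpos.le).trans h1
  rw [show K * S₀ / m * r ^ (γ₁ s) = (K * r ^ (γ₁ s) * S₀) / m by ring, le_div_iff₀ hm]
  have h4 : l * (r ^ g * m) ≤ l * (K * r ^ (γ₁ s) * S₀) := by
    have heq : K * r ^ (γ₁ s) * s = l * (K * r ^ (γ₁ s) * S₀) := by rw [← hlS]; ring
    calc l * (r ^ g * m) = l * (m * r ^ g) := by ring
      _ ≤ K * r ^ (γ₁ s) * s := h3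
      _ = l * (K * r ^ (γ₁ s) * S₀) := heq
  exact le_of_mul_le_mul_left h4 hlpos

/-- **…AND THE FUNNEL MAKES THE CONSTANT NON-POSITIVE.**  If the cone contains, for every `ε > 0`,
a member saturating an exponent `g ≤ ε` (ROUND-15: the funnel of gauge `N` has
`γ(N) ≤ 2√(N/π)e^{-N/4} → 0`, `linearHolderLaw_ceiling`), then every swirl-gauged profile valid
on the class is `≤ 0` on `(0, ∞)`: NO positive swirl-gauged law exists for passive swirls.  Any
proof of `SwirlGaugedLaw` must use the coupling `u ↔ Θ`. -/
theorem gaugedExponent_nonpos_of_funnels {K : ℝ} {γ₁ : ℝ → ℝ} (hK : 0 < K)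
    (hfunnels : ∀ ε : ℝ, 0 < ε → ∃ (osc : ℝ → ℝ) (S₀ m g : ℝ), 0 < S₀ ∧ 0 < m ∧ g ≤ ε ∧
      (∀ r : ℝ, 0 < r → r ≤ 1 → m * r ^ g ≤ osc r) ∧
      (∀ l : ℝ, 0 < l → ∀ r : ℝ, 0 < r → r ≤ 1 →
        l * osc r ≤ K * r ^ (γ₁ (l * S₀)) * (l * S₀))) :
    ∀ s : ℝ, 0 < s → γ₁ s ≤ 0 := by
  intro s hs
  apply le_of_forall_pos_le_add
  intro ε hε
  obtain ⟨osc, S₀, m, g, hS₀, hm, hg, hlow, hlaw⟩ := hfunnels ε hε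
  have := gaugedExponent_le_of_cone hS₀ hm hK hlow hlaw s hs
  linarith

end

end Summit.NavierStokesRegularity.NavierStokesRegularity.Theorems.SwirlGaugedTower
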